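import Summits.QuantumAdvantage.QuantumAdvantage.Theorems.LabelSurjectiveLawA
import Summits.QuantumAdvantage.QuantumAdvantage.Theorems.QuadSaturationA

set_option linter.dupNamespace false
set_option linter.unusedSectionVars false

/-!
# ColumnBridgeA (lens 4, g29; the (P6) bridge of the (c0) road) — FROM QUADRATIC SATURATION ON THE COLUMN POOL TO LOSS

Blocker `X = AbsorptionDial.NoPerfectPolyOdd` (item 28487); decomp-qadv lens 4, g29.  Pure bookkeeping joining the two kernel halves of the road:
`QuadSaturation.quad_saturation` ((P4): a labelled quadratic map on a product of two cubes is onto when its linear part is free and its cross block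
disperses) and `LabelSurjective.loss_of_columnSaturation` ((P3): column saturation of the labelled quadratic subset-sum map forces a loss).

The column pool is `m` coordinates `T : Fin m ↪ Fin n`, split by `side : Fin m → Bool` into `Side₁ = {side = true}` and `Side₂`; a point
`x = (x₁, x₂)` of the product cube is sent to the column set `colSet T side x = T({i : glue x i})`.  `sum_colSet` computes set sums over it; then
`cross_colSet` / `label_colSet` (the cross terms with the cut rows `e` and the labels are the LINEAR coordinates `Lfull = Fin.append cross label`
restricted to the two sides), `qSet_colSet` (the internal quadratic value is `Q₁(x₁) + Q₂(x₂) + x₁ᵀ Cx x₂` with `Cx i j = M(Ti)(Tj) + M(Tj)(Ti)` the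
symmetrised cross block of the bipartition), `walk_colSet` (the walk datum mod 3 is the weighted count with weights `1 + [T i < g] ∈ {1,2}`).
★ `colSat_of_free_disperse` — (d1) joint freeness of the `r + k` cross/label forms on the pool (weight `≥ w`), (d2′) a dispersing bipartition,
smallness ⟹ the saturation hypothesis `hsat` of `loss_of_columnSaturation` with ALL label values (`V′ = univ`);
★ `loss_of_freeDisperse` — the DISPERSING BRANCH of (c0) as one kernel statement: registers `g ≠ g₀` `k`-forms, `g₀ = H(labels, quadratic value)`,
an unbalanced cut (`r` rows `e`, `m` columns `T`), (d1), (d2′), smallness and the two counts ⟹ `∃ u, ringWinU c y u = false`.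
What remains of (c0) in print after this file: producing (d1) from kernel Y ((PS)+K1) and the cut, and the NON-dispersing branch ((P7) = K3 + K4).
-/

open Finset
open Summit.QuantumAdvantage.AdviceFreeQNC0
open Summit.QuantumAdvantage.QuantumAdvantage.Theorems.InnerDegreeDial
open Summit.QuantumAdvantage.QuantumAdvantage.Theorems.BilinearCubeSum
open Summit.QuantumAdvantage.QuantumAdvantage.Theorems.QuadSaturation
open Summit.QuantumAdvantage.QuantumAdvantage.Theorems.LabelSurjective

namespace Summit.QuantumAdvantage.QuantumAdvantage.Theorems.ColumnBridge

variable {p : ℕ} [Fact p.Prime] {n m : ℕ}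

/-! ### 1. The bipartition of the column pool and the column set of a product-cube point -/

/-- the first side of the bipartition -/
abbrev Side₁ (side : Fin m → Bool) : Type := {i : Fin m // side i = true}

/-- the second side of the bipartition -/
abbrev Side₂ (side : Fin m → Bool) : Type := {i : Fin m // ¬ side i = true}

/-- glue a product-cube point to a point of `{0,1}^m` -/
def glue (side : Fin m → Bool) (x : (Side₁ side → Bool) × (Side₂ side → Bool)) : Fin m → Bool :=
  fun i => if h : side i = true then x.1 ⟨i, h⟩ else x.2 ⟨i, h⟩

/-- the column set of a product-cube point: the `T`-image of its support -/
def colSet (T : Fin m ↪ Fin n) (side : Fin m → Bool) (x : (Side₁ side → Bool) × (Side₂ side → Bool)) : Finset (Fin n) :=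
  (univ.filter fun i => glue side x i = true).map T

/-- the column set lies in the pool -/
theorem colSet_subset (T : Fin m ↪ Fin n) (side : Fin m → Bool) (x : (Side₁ side → Bool) × (Side₂ side → Bool)) :
    colSet T side x ⊆ univ.map T :=
  map_subset_map.2 (filter_subset _ _)

/-- **set sums over the column set split along the bipartition** -/
theorem sum_colSet {R : Type*} [AddCommMonoid R] (T : Fin m ↪ Fin n) (side : Fin m → Bool)
    (x : (Side₁ side → Bool) × (Side₂ side → Bool)) (f : Fin n → R) :
    ∑ l ∈ colSet T side x, f l
      = (∑ i : Side₁ side, if x.1 i then f (T i.1) else 0) + ∑ i : Side₂ side, if x.2 i then f (T i.1) else 0 := by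
  unfold colSet
  rw [sum_map, sum_filter, ← Fintype.sum_subtype_add_sum_subtype (fun i : Fin m => side i = true)]
  congr 1
  · refine Fintype.sum_congr _ _ fun i => ?_
    simp [glue, i.2]
  · refine Fintype.sum_congr _ _ fun i => ?_
    simp [glue, i.2]

/-- the two sides exhaust the pool -/
theorem card_sides (side : Fin m → Bool) : Fintype.card (Side₁ side) + Fintype.card (Side₂ side) = m := by
  have h1 : Fintype.card (Side₂ side) = Fintype.card (Fin m) - Fintype.card (Side₁ side) := Fintype.card_subtype_compl _
  have h2 : Fintype.card (Side₁ side) ≤ Fintype.card (Fin m) := Fintype.card_subtype_le _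
  rw [Fintype.card_fin] at h1 h2
  omega

/-- a count over the pool splits along the bipartition -/
theorem card_filter_sides (side : Fin m → Bool) (P : Fin m → Prop) [DecidablePred P] :
    (univ.filter P).card = (univ.filter fun i : Side₁ side => P i.1).card + (univ.filter fun i : Side₂ side => P i.1).card := by
  rw [card_filter, card_filter, card_filter, ← Fintype.sum_subtype_add_sum_subtype (fun i : Fin m => side i = true)]

/-! ### 2. The data of the bridge -/

section Data

variable {k r : ℕ}

/-- the `r + k` linear forms on the pool: cross terms with the cut rows, then the labels -/
def Lfull (M : Fin n → Fin n → ZMod p) (Λ : Fin k → Fin n → ZMod p) (e : Fin r ↪ Fin n) (T : Fin m ↪ Fin n) :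
    Fin (r + k) → Fin m → ZMod p :=
  Fin.append (fun j i => M (e j) (T i) + M (T i) (e j)) (fun j i => Λ j (T i))

/-- restriction to the first side -/
def L₁ (M : Fin n → Fin n → ZMod p) (Λ : Fin k → Fin n → ZMod p) (e : Fin r ↪ Fin n) (T : Fin m ↪ Fin n) (side : Fin m → Bool) :
    Fin (r + k) → Side₁ side → ZMod p := fun j i => Lfull M Λ e T j i.1

/-- restriction to the second side -/
def L₂ (M : Fin n → Fin n → ZMod p) (Λ : Fin k → Fin n → ZMod p) (e : Fin r ↪ Fin n) (T : Fin m ↪ Fin n) (side : Fin m → Bool) :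
    Fin (r + k) → Side₂ side → ZMod p := fun j i => Lfull M Λ e T j i.1

/-- the one-sided part of the internal quadratic value on the first side -/
def Q₁ (M : Fin n → Fin n → ZMod p) (b : Fin n → ZMod p) (T : Fin m ↪ Fin n) (side : Fin m → Bool) (x₁ : Side₁ side → Bool) : ZMod p :=
  (∑ i : Side₁ side, if x₁ i then (∑ i' : Side₁ side, if x₁ i' then M (T i.1) (T i'.1) else 0) else 0)
    + ∑ i : Side₁ side, if x₁ i then b (T i.1) else 0

/-- the one-sided part on the second side -/
def Q₂ (M : Fin n → Fin n → ZMod p) (b : Fin n → ZMod p) (T : Fin m ↪ Fin n) (side : Fin m → Bool) (x₂ : Side₂ side → Bool) : ZMod p :=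
  (∑ i : Side₂ side, if x₂ i then (∑ i' : Side₂ side, if x₂ i' then M (T i.1) (T i'.1) else 0) else 0)
    + ∑ i : Side₂ side, if x₂ i then b (T i.1) else 0

/-- the symmetrised cross block of the bipartition -/
def Cx (M : Fin n → Fin n → ZMod p) (T : Fin m ↪ Fin n) (side : Fin m → Bool) : Side₁ side → Side₂ side → ZMod p :=
  fun i j => M (T i.1) (T j.1) + M (T j.1) (T i.1)

/-- the walk weights `1 + [T i < g] ∈ {1, 2}` on the first side -/
def ww₁ (T : Fin m ↪ Fin n) (side : Fin m → Bool) (g : ℕ) : Side₁ side → ZMod 3 :=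
  fun i => 1 + if (T i.1).val < g then 1 else 0

/-- the walk weights on the second side -/
def ww₂ (T : Fin m ↪ Fin n) (side : Fin m → Bool) (g : ℕ) : Side₂ side → ZMod 3 :=
  fun i => 1 + if (T i.1).val < g then 1 else 0

/-- the weights are non-zero mod 3 -/
theorem ww₁_ne_zero (T : Fin m ↪ Fin n) (side : Fin m → Bool) (g : ℕ) (i : Side₁ side) : ww₁ T side g i ≠ 0 := by
  unfold ww₁; split_ifs <;> decide

/-- the weights are non-zero mod 3 -/
theorem ww₂_ne_zero (T : Fin m ↪ Fin n) (side : Fin m → Bool) (g : ℕ) (i : Side₂ side) : ww₂ T side g i ≠ 0 := by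
  unfold ww₂; split_ifs <;> decide

/-! ### 3. The four quantities of a column set -/

/-- cross terms with a cut row are the linear coordinate `castAdd j` -/
theorem cross_colSet (M : Fin n → Fin n → ZMod p) (Λ : Fin k → Fin n → ZMod p) (e : Fin r ↪ Fin n) (T : Fin m ↪ Fin n)
    (side : Fin m → Bool) (x : (Side₁ side → Bool) × (Side₂ side → Bool)) (j : Fin r) :
    ∑ l ∈ colSet T side x, (M (e j) l + M l (e j)) = linPart (L₁ M Λ e T side) (L₂ M Λ e T side) x (Fin.castAdd k j) := by
  rw [sum_colSet]
  unfold linPart cubePhase L₁ L₂ Lfull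
  simp only [Fin.append_left]

/-- labels are the linear coordinate `natAdd j` -/
theorem label_colSet (M : Fin n → Fin n → ZMod p) (Λ : Fin k → Fin n → ZMod p) (e : Fin r ↪ Fin n) (T : Fin m ↪ Fin n)
    (side : Fin m → Bool) (x : (Side₁ side → Bool) × (Side₂ side → Bool)) (j : Fin k) :
    ∑ l ∈ colSet T side x, Λ j l = linPart (L₁ M Λ e T side) (L₂ M Λ e T side) x (Fin.natAdd r j) := by
  rw [sum_colSet]
  unfold linPart cubePhase L₁ L₂ Lfull
  simp only [Fin.append_right]

omit [Fact p.Prime] in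
/-- swapping a double sum of guarded terms -/
theorem ite_sum_swap {α β R : Type*} [Fintype α] [Fintype β] [AddCommMonoid R] (P : α → Bool) (Q : β → Bool) (f : α → β → R) :
    (∑ i, if P i then (∑ j, if Q j then f i j else 0) else 0) = ∑ j, if Q j then (∑ i, if P i then f i j else 0) else 0 := by
  have h1 : ∀ i, (if P i then (∑ j, if Q j then f i j else 0) else 0) = ∑ j, if P i then (if Q j then f i j else 0) else 0 := by
    intro i; split_ifs <;> simp
  have h2 : ∀ j, (if Q j then (∑ i, if P i then f i j else 0) else 0) = ∑ i, if Q j then (if P i then f i j else 0) else 0 := by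
    intro j; split_ifs <;> simp
  simp_rw [h1, h2]
  rw [sum_comm]
  refine sum_congr rfl fun j _ => sum_congr rfl fun i _ => ?_
  split_ifs <;> rfl

omit [Fact p.Prime] in
/-- adding two guarded terms with the same guard -/
theorem ite_add_ite_zero {R : Type*} [AddZeroClass R] (c : Prop) [Decidable c] (a b : R) :
    (if c then a else 0) + (if c then b else 0) = if c then a + b else 0 := by
  split_ifs <;> simp

/-- **the internal quadratic value of a column set**: one-sided parts plus the bilinear cross phase -/
theorem qSet_colSet (M : Fin n → Fin n → ZMod p) (b : Fin n → ZMod p) (T : Fin m ↪ Fin n) (side : Fin m → Bool)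
    (x : (Side₁ side → Bool) × (Side₂ side → Bool)) :
    qSet M b (colSet T side x) = quadPart (Q₁ M b T side) (Q₂ M b T side) (Cx M T side) x := by
  unfold qSet quadPart
  -- inner sums
  have hinner : ∀ l, ∑ l' ∈ colSet T side x, M l l'
      = (∑ i' : Side₁ side, if x.1 i' then M l (T i'.1) else 0) + ∑ i' : Side₂ side, if x.2 i' then M l (T i'.1) else 0 :=
    fun l => sum_colSet T side x (M l)
  simp_rw [hinner]
  rw [sum_colSet, sum_colSet]
  -- split the guards over the inner `+`
  simp_rw [← ite_add_ite_zero, sum_add_distrib]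
  -- the mixed block of the first side, swapped
  rw [ite_sum_swap x.1 x.2 (fun i j => M (T i.1) (T j.1))]
  -- the cross phase
  have hcross : cubePhase (rowForm (Cx M T side) x.1) x.2
      = (∑ j : Side₂ side, if x.2 j then (∑ i : Side₁ side, if x.1 i then M (T i.1) (T j.1) else 0) else 0)
        + ∑ j : Side₂ side, if x.2 j then (∑ i : Side₁ side, if x.1 i then M (T j.1) (T i.1) else 0) else 0 := by
    unfold cubePhase rowForm Cx
    rw [← sum_add_distrib]
    refine sum_congr rfl fun j _ => ?_
    rw [ite_add_ite_zero, ← sum_add_distrib]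
    congr 1
    refine sum_congr rfl fun i _ => ?_
    rw [ite_add_ite_zero]
  rw [hcross]
  unfold Q₁ Q₂
  abel

/-- **the walk datum of a column set mod 3** is the weighted count -/
theorem walk_colSet (T : Fin m ↪ Fin n) (side : Fin m → Bool) (g : ℕ) (x : (Side₁ side → Bool) × (Side₂ side → Bool)) :
    ((walkDatum (colSet T side x) g : ℕ) : ZMod 3) = walkPart (ww₁ T side g) (ww₂ T side g) x := by
  have hw : walkDatum (colSet T side x) g = ∑ l ∈ colSet T side x, (1 + if l.val < g then 1 else 0) := by
    unfold walkDatum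
    rw [card_eq_sum_ones, card_filter, ← sum_add_distrib]
  rw [hw, sum_colSet]
  unfold walkPart cubeW ww₁ ww₂
  push_cast
  congr 1

end Data

/-! ### 4. Saturation of the column map from freeness and dispersion -/

/-- **COLUMN SATURATION FROM (d1) + (d2′) ((P4) on the pool, in the form `hsat` of `loss_of_columnSaturation` with all label values).** -/
theorem colSat_of_free_disperse (hp3 : p.Coprime 3) {k r : ℕ} (M : Fin n → Fin n → ZMod p) (b : Fin n → ZMod p)
    (Λ : Fin k → Fin n → ZMod p) (e : Fin r ↪ Fin n) (T : Fin m ↪ Fin n) (side : Fin m → Bool) (g : ℕ)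
    (w : ℕ) (hw : w ≤ m)
    (hfree : ∀ γ : Fin (r + k) → ZMod p, γ ≠ 0 → w ≤ (univ.filter fun i : Fin m => (∑ j, γ j * Lfull M Λ e T j i) ≠ 0).card)
    (w₂ E : ℕ)
    (hdisp : (univ.filter fun xx : (Side₁ side → Bool) × (Side₁ side → Bool) =>
      (univ.filter fun j => (rowForm (Cx M T side) xx.1 - rowForm (Cx M T side) xx.2) j ≠ 0).card < w₂).card ≤ E)
    (hsmall : 3 * (p : ℝ) ^ (r + k + 1) *
      (Real.cos (Real.pi / (p * 3)) ^ w
        + Real.sqrt (E + 4 ^ Fintype.card (Side₁ side) * Real.cos (Real.pi / p) ^ w₂) / 2 ^ Fintype.card (Side₁ side)) < 1)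
    (μ : Fin k → ZMod p) (β : ℕ) (xt : Fin r → ZMod p) (t : ZMod p) :
    ∃ A : Finset (Fin n), A ⊆ univ.map T ∧
      (∀ j, (∑ l ∈ A, (M (e j) l + M l (e j))) = xt j) ∧ qSet M b A = t ∧
      (fun j => ∑ l ∈ A, Λ j l) = μ ∧ walkDatum A g % 3 = β % 3 := by
  classical
  have hw' : w ≤ Fintype.card (Side₁ side) + Fintype.card (Side₂ side) := by rw [card_sides]; exact hw
  have hfree' : ∀ γ : Fin (r + k) → ZMod p, γ ≠ 0 →
      w ≤ (univ.filter fun i : Side₁ side => (∑ j, γ j * L₁ M Λ e T side j i) ≠ 0).card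
        + (univ.filter fun i : Side₂ side => (∑ j, γ j * L₂ M Λ e T side j i) ≠ 0).card := by
    intro γ hγ
    have := hfree γ hγ
    rw [card_filter_sides side] at this
    exact this
  obtain ⟨x, hlin, hquad, hwalk⟩ := quad_saturation hp3 (L₁ M Λ e T side) (L₂ M Λ e T side)
    (Q₁ M b T side) (Q₂ M b T side) (Cx M T side) (ww₁ T side g) (ww₂ T side g) (ww₁_ne_zero T side g) (ww₂_ne_zero T side g)
    w hw' hfree' w₂ E hdisp hsmall (Fin.append xt μ) t (β : ZMod 3)
  refine ⟨colSet T side x, colSet_subset T side x, fun j => ?_, ?_, ?_, ?_⟩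
  · rw [cross_colSet, hlin, Fin.append_left]
  · rw [qSet_colSet, hquad]
  · funext j
    rw [label_colSet, hlin, Fin.append_right]
  · rw [← ZMod.natCast_eq_natCast_iff', walk_colSet, hwalk]

/-! ### 5. The dispersing branch of (c0): loss -/

/-- **LOSS ON THE DISPERSING BRANCH ((P3)+(P4) of the (c0) road, kernel).**  Registers `g ≠ g₀` are `k`-forms; `g₀ = H(labels, quadratic value)`;
an unbalanced cut — `r` row coordinates `e`, `m` column coordinates `T`, disjoint — with (d1) the `r + k` cross/label forms jointly free of weight
`≥ w` on the pool, (d2′) a bipartition `side` of the pool whose cross block disperses, the smallness condition, LAW C's count on the pool and the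
class count `3·p^{2k}·((n+1)·2p^k + 1) < 2^r`.  Then some input loses. -/
theorem loss_of_freeDisperse (hp5 : 5 ≤ p) (hp3 : p.Coprime 3) {k r : ℕ} (c : ℕ)
    (y : Fin (n + 1) → (Fin n → Bool) → Bool) (g₀ : Fin (n + 1))
    (lam : Fin (n + 1) → Fin k → Fin n → ZMod p) (F : Fin (n + 1) → (Fin k → ZMod p) → Bool)
    (hF : ∀ g, g ≠ g₀ → ∀ u, y g u = F g (fun j => ∑ i, if u i = true then lam g j i else 0))
    (Λ : Fin k → Fin n → ZMod p) (M : Fin n → Fin n → ZMod p) (b : Fin n → ZMod p)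
    (H : (Fin k → ZMod p) → ZMod p → Bool)
    (hy₀ : ∀ u, y g₀ u = H (fun j => ∑ i, if u i = true then Λ j i else 0) (quadVal M b u))
    (e : Fin r ↪ Fin n) (T : Fin m ↪ Fin n) (heT : ∀ j i, e j ≠ T i) (side : Fin m → Bool)
    (w : ℕ) (hw : w ≤ m)
    (hfree : ∀ γ : Fin (r + k) → ZMod p, γ ≠ 0 → w ≤ (univ.filter fun i : Fin m => (∑ j, γ j * Lfull M Λ e T j i) ≠ 0).card)
    (w₂ E : ℕ)
    (hdisp : (univ.filter fun xx : (Side₁ side → Bool) × (Side₁ side → Bool) =>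
      (univ.filter fun j => (rowForm (Cx M T side) xx.1 - rowForm (Cx M T side) xx.2) j ≠ 0).card < w₂).card ≤ E)
    (hsmall : 3 * (p : ℝ) ^ (r + k + 1) *
      (Real.cos (Real.pi / (p * 3)) ^ w
        + Real.sqrt (E + 4 ^ Fintype.card (Side₁ side) * Real.cos (Real.pi / p) ^ w₂) / 2 ^ Fintype.card (Side₁ side)) < 1)
    (hcountA : (n + 1) * (p ^ k * 2) * (2 * p - 1) ^ m < (2 * p) ^ m)
    (hcountB : 3 * p ^ k * p ^ k * ((n + 1) * (p ^ k * 2) + 1) < 2 ^ r) :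
    ∃ u, ringWinU c y u = false := by
  classical
  refine loss_of_columnSaturation hp5 c y g₀ lam F hF Λ M b H hy₀ e T heT univ (fun A _ => mem_univ _) ?_ hcountA ?_
  · intro μ _ β xt t
    exact colSat_of_free_disperse hp3 M b Λ e T side g₀.val w hw hfree w₂ E hdisp hsmall μ β xt t
  · rwa [card_univ, Fintype.card_fun, ZMod.card, Fintype.card_fin]

end Summit.QuantumAdvantage.QuantumAdvantage.Theorems.ColumnBridge
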